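import Summits.BirchSwinnertonDyer.BirchSwinnertonDyer.Theorems.ManinLocalTwoThreeManinOddAtFourKernelSplit
import Summits.BirchSwinnertonDyer.BirchSwinnertonDyer.Theorems.ManinLocalTwoThreeShimuraKernelBlindNecessary
import Summits.BirchSwinnertonDyer.BirchSwinnertonDyer.Theorems.ManinLocalTwoThreeGammaOneIndexFour
import HarnessLib

/-!
# C2 — THE LEDGER SPLIT: the gain locus is fed by EXACTLY the two bits of the C2-ledger — E-an-151|_G «no doubling, |c₀| = |c₁|» and OddStevens|_G «2 ∤ c₁ for the Stevens curve of
# a one-root BLIND gain class off the period-dominated locus» — both NECESSARY for C2; Kato–Néron integrality at E₁ (v23–v28's 6♭‴) leaves the skeleton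
(route `ManinLocalTwoThree`, deciding crux C2 `ManinOddAtFour` stmt-BirchSwinnertonDyer-22967; cell bsd-f2-manin, prover p3 gen 18; a v29-candidate composition;
`--supports stmt-BirchSwinnertonDyer-22967`; sequel to `…ManinOddAtFourTransferSplit` (p750037))

WHY.  In the transfer split (v28) the blind branch ran the v23 blind road `not_two_dvd_maninConstant_of_katoFactAt₁_of_allBlind`: Kato–Néron integrality at the `X₁(N)`-optimal
curve `E₁` ⟹ `2 ∤ c₁` (Γ₁ Kato lever) and F★'s transfer `|c₀| = |c₁|`.  But on the gain locus v28 ALREADY holds `|c₀| = |c₁|` (row E-an-151|_G), so only the bit «`2 ∤ c₁`» is consumed —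
and that bit is exactly the second half of the C2-ledger `not_two_dvd_maninConstant₀_iff_of_four_dvd_level` (`2 ∤ c₀ ⟺ 2 ∤ c₁ ∧ |c₀| = |c₁|`).  So the row 6♭‴|_G (`KatoFactTwoAt V D₁.f`)
is WEAKENED to **OddStevens|_G: `¬ 2 ∣ D₁.maninConstant`** under the same guard (optimal `X₁`-datum of a one-root all-blind gain class on the core at `16 ∣ N`, NOT period-dominated by a
symbol-closure relative — on the period-dominated locus F-es-21♭K still gives Kato at `E₁` by `katoFactTwoAt_of_isIsogenous_of_realPeriod_ratio`, hence `2 ∤ c₁` by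
`not_two_dvd_maninConstant₁_of_katoFactAt`, a PRINTED discharge).
* §1 `not_two_dvd_maninConstant_of_ledgerLawsG_core`; §2 `maninOddAtSixteenCore_of_v29`, `maninOddAtFour_of_katoFact_udcTwo_ledgerLawsG`; §3 **`maninOddAtFour_of_katoFact_CDT_ledgerLawsG`**
  (route decl BY NAME from F♯, F★, F♮, CES, F-es-21♭K, CDT-algInt and the two OPEN rows E-an-151|_G, OddStevens|_G inline) and **`maninOddAtFour_of_katoFact_CDT_ledgerRow151`** (E-an-151 by
  -an's name `ShimuraKernel.GammaOneTransferAtFour`).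
NECESSITY (tree): E-an-151 ⟸ C2 (`ShimuraKernel.gammaOneTransferAtFour_of_body`); OddStevens ⟸ C2 on the class (ledger, given no doubling).  **v29 stubs = 3 printed + E-an-151|_G +
OddStevens|_G (5), the skeleton form of «C2 on the gain locus = no doubling ∧ Stevens-odd» (LEAD-MEMO v37 §3)** — habitat of E-an-151|_G: all gain classes on the core at `16 ∣ N`;
habitat of OddStevens|_G: one-root (equivalently, given no doubling, all-blind) gain classes off the period-dominated locus.
HONEST FRAMING.  CONDITIONAL reduction; both rows are OPEN (together they ARE C2 on the gain locus); CDT and the cusp/Kato facts are printed, not proved in the tree; C2, Manin's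
conjecture and BSD are NOT proved.  No definitions, no sorry.
[cite: Kato2004Asterisque, Thm. 12.5 (1) (p. 221) and (8.1.3) (p. 180)] [cite: ConradEdixhovenStein2003, §6.1.2 and §6.2] [cite: Stevens1982, Thm. 1.3.1] [cite: Stevens1989, §2]
[cite: KurthLong2008, Prop. 18] [cite: CalegariDimitrovTang2025, Thm. 1.0.1 and Remarks 58–59] [cite: CesnaviciusNeururerSaha2023, Lemma 6.5]
-/

set_option autoImplicit false
-- lint-debt: the directory name repeats the summit name (sibling precedent `ManinLocalTwoThreeManinOddAtFourTransferSplit.lean`)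
set_option linter.dupNamespace false

noncomputable section

open scoped Classical MatrixGroups ModularForm NumberField PeriodPair Manifold
open PowerSeries CongruenceSubgroup IsDedekindDomain IsDedekindDomain.HeightOneSpectrum Rat.HeightOneSpectrum
open WeierstrassCurve Literature.NumberTheory.DiophantineGeometry Literature.NumberTheory.EllipticCurves
  Literature.NumberTheory.EllipticCurves.ModularForms Literature.RingTheory.FormalGroups
open Summit.BirchSwinnertonDyer.Rank1Residual.ManinAdditive
open Summit.BirchSwinnertonDyer.Rank1Residual.ManinAdditive.CuspidalKummer
open Summit.BirchSwinnertonDyer.Rank1Residual.ManinAdditive.ShimuraLedger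
open Summit.BirchSwinnertonDyer.Rank1Residual.ManinAdditive.KatoCurve
open Summit.BirchSwinnertonDyer.Rank1Residual.ManinAdditive.ShimuraKernel
open Summit.BirchSwinnertonDyer.BirchSwinnertonDyer.Theorems.ManinLocalTwoThree.SigmaSquareRoot
open Summit.BirchSwinnertonDyer.BirchSwinnertonDyer.Theorems.ManinLocalTwoThree.SigmaHabitat
open Summit.BirchSwinnertonDyer.BirchSwinnertonDyer.Theorems.ManinLocalTwoThree.KernelSplit
open Summit.BirchSwinnertonDyer.Rank1Residual.ManinAdditive.UDCKummerLineK

namespace Summit.BirchSwinnertonDyer.BirchSwinnertonDyer.Theorems.ManinLocalTwoThree.LedgerSplit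

/-! ## §1 The datum-level composition with the transfer split -/

/-- **C2 LEVEL-WISE on the core, LEDGER split** (`4 ∣ N`): irreducible `W[2]` by F♯; `Λ₁(f) = Λ₀(f)` by `hEven`; on the gain locus the optimal `X₁(N)`-datum (CES) and the row
E-an-151|_G (`|c₀| = |c₁|`) exclude index `4` (`natAbs_maninConstant₀_eq_two_mul_of_index_four`) and give a blind rational root (`shimuraKernelBlindAt_of_natAbs_eq`); then a second
rational root contradicts `2 ∣ c` (`hTwoRootsN`), and total blindness yields Stevens' parity `2 ∤ c₁` (F-es-21♭K on the period-dominated locus, the row `hOddN` otherwise), which no doubling transfers to `D`.  CONDITIONAL reduction; nothing about BSD or Manin's conjecture is proved.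
[cite: Stevens1989, §2] [cite: Kato2004Asterisque, Thm. 12.5 (1) (p. 221)] [cite: ConradEdixhovenStein2003, §6.1.2] -/
theorem not_two_dvd_maninConstant_of_ledgerLawsG_core
    (hF : kato_neron_isIntegral_twistedSymbolSum_of_additive_two_real)
    (hFstar : optimalGamma1Parametrization_cusp_rational) (hFnat : optimalGamma1Parametrization_cuspZero_galoisConjugate)
    (hex : exists_optimal_gamma1ParametrizationData)
    {N : ℕ} [NeZero N] (h4 : 2 ^ 2 ∣ N)
    (hEven : ∀ (V : WeierstrassCurve ℚ) [V.IsElliptic] [V.IsGloballyMinimal] (D : ModularParametrizationData V N),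
      (∀ z ∈ D.L.lattice, ∃ w ∈ periodLattice D.f, z = D.c * w) →
      ∀ e : ℚ, V.twoTorsionPolynomial.toPoly.IsRoot e → (2 : ℤ) ∣ D.c → periodLatticeGamma1 D.f ≠ periodLattice D.f)
    (hTwoRootsN : ∀ (V : WeierstrassCurve ℚ) [V.IsElliptic] [V.IsGloballyMinimal] (D : ModularParametrizationData V N),
      (∀ z ∈ D.L.lattice, ∃ w ∈ periodLattice D.f, z = D.c * w) →
      ∀ e e' : ℚ, V.twoTorsionPolynomial.toPoly.IsRoot e → V.twoTorsionPolynomial.toPoly.IsRoot e' → e ≠ e' →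
      ¬ (∀ z : ℂ, z ∈ periodLatticeGamma1 D.f ↔ ∃ w ∈ periodLattice D.f, z = 2 * w) → ¬ (2 : ℤ) ∣ D.maninConstant)
    (h151N : ∀ (V₁ V : WeierstrassCurve ℚ) [V₁.IsElliptic] [V₁.IsGloballyMinimal] [V.IsElliptic] [V.IsGloballyMinimal]
      (D₁ : Gamma1ParametrizationData V₁ N) (D : ModularParametrizationData V N), IsIsogenous V₁ V → D₁.IsOptimal →
      (∀ z ∈ D.L.lattice, ∃ w ∈ periodLattice D.f, z = D.c * w) →
      ((primesEquiv (R := 𝓞 ℚ)).symm ⟨2, Nat.prime_two⟩).valuation ℚ V.j < 1 → (∀ d : ℤ, d = -1 ∨ d = 2 ∨ d = -2 → 2 ≤ (V.quadraticTwist (d : ℚ)).conductorExponent ((primesEquiv (R := ℤ)).symm ⟨2, Nat.prime_two⟩)) →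
      modularSymbol D.f 0 ∉ periodLattice D.f → periodLatticeGamma1 D.f ≠ periodLattice D.f → V.a₁ = 0 → V.a₃ = 0 →
      D.maninConstant.natAbs = D₁.maninConstant.natAbs)
    (hK : kato_isIntegral_twistedSymbolSum_two_symbolClosure)
    (hOddN : ∀ (V : WeierstrassCurve ℚ) [V.IsElliptic] [V.IsGloballyMinimal] (D₁ : Gamma1ParametrizationData V N),
      D₁.IsOptimal →
      (¬ ∃ (V' : WeierstrassCurve ℚ) (_ : V'.IsElliptic) (_ : V'.IsGloballyMinimal) (q m : ℤ),
        Odd q ∧ WeierstrassCurve.IsIsogenous V' V ∧ (q : ℝ) * V'.realPeriodRat = (m : ℝ) * V.realPeriodRat ∧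
        IsSymbolClosureCurve V' D₁.f) →
      (∃ (W₀ : WeierstrassCurve ℚ) (_ : W₀.IsElliptic) (_ : W₀.IsGloballyMinimal) (D₀ : ModularParametrizationData W₀ N),
        IsIsogenous V W₀ ∧ (∀ z ∈ D₀.L.lattice, ∃ w ∈ periodLattice D₀.f, z = D₀.c * w) ∧
        W₀.a₁ = 0 ∧ W₀.a₃ = 0 ∧ HasRationalTwoTorsion W₀ ∧ AllRationalTwoTorsionBlind W₀ ∧
        ((primesEquiv (R := 𝓞 ℚ)).symm ⟨2, Nat.prime_two⟩).valuation ℚ W₀.j < 1 ∧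
        (∀ d : ℤ, d = -1 ∨ d = 2 ∨ d = -2 → 2 ≤ (W₀.quadraticTwist (d : ℚ)).conductorExponent ((primesEquiv (R := ℤ)).symm ⟨2, Nat.prime_two⟩)) ∧
        modularSymbol D₀.f 0 ∉ periodLattice D₀.f ∧ periodLatticeGamma1 D₀.f ≠ periodLattice D₀.f) →
      ¬ (2 : ℤ) ∣ D₁.maninConstant)
    (W : WeierstrassCurve ℚ) [W.IsElliptic] [W.IsGloballyMinimal] (D : ModularParametrizationData W N)
    (hopt : ∀ z ∈ D.L.lattice, ∃ w ∈ periodLattice D.f, z = D.c * w)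
    (hss : ((primesEquiv (R := 𝓞 ℚ)).symm ⟨2, Nat.prime_two⟩).valuation ℚ W.j < 1) (hcore : (∀ d : ℤ, d = -1 ∨ d = 2 ∨ d = -2 → 2 ≤ (W.quadraticTwist (d : ℚ)).conductorExponent ((primesEquiv (R := ℤ)).symm ⟨2, Nat.prime_two⟩))) :
    ¬ (2 : ℤ) ∣ D.maninConstant := by
  by_cases hirr : W.HasIrreducibleModPGaloisRep 2
  · exact katoManinOddTwo_of_real_of_exists_gamma1 hF hex W D hopt h4 hirr
  have h4' : 4 ∣ N := by norm_num at h4; exact h4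
  obtain ⟨h2, hN2⟩ := lFunction_two_eq_zero_of_four_dvd W D.isNewformOf h4'
  have hadd := hasAdditiveReductionAt_two_of_lFunction_two_eq_zero W h2 hN2
  obtain ⟨C, M, hu, hCW, hM1, hM3, hmin⟩ := exists_smul_eq_map_a₁_a₃_eq_zero_of_hasAdditiveReductionAt_two W hadd
  haveI := hmin
  obtain ⟨D', hf, hc, hL, -⟩ := exists_modularParametrizationData_smul_of_u_eq_one W D C hu
  have hopt' : ∀ z ∈ D'.L.lattice, ∃ w ∈ periodLattice D'.f, z = D'.c * w := by
    rw [hL, hf, hc]; exact hopt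
  have ha₁ : (C • W).a₁ = 0 := by rw [hCW, map_a₁, hM1, map_zero]
  have ha₃ : (C • W).a₃ = 0 := by rw [hCW, map_a₃, hM3, map_zero]
  have hssC : ((primesEquiv (R := 𝓞 ℚ)).symm ⟨2, Nat.prime_two⟩).valuation ℚ (C • W).j < 1 := by
    rw [variableChange_j]; exact hss
  have hcoreC := twistCore_smul W C hcore
  suffices h : ¬ (2 : ℤ) ∣ D'.maninConstant by
    change ¬ (2 : ℤ) ∣ D'.c at h
    change ¬ (2 : ℤ) ∣ D.c
    rwa [hc] at h
  have hred' : ¬ (C • W).HasIrreducibleModPGaloisRep 2 := by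
    rwa [Mazur1978.hasIrreducibleModPGaloisRep_smul_iff]
  by_cases hΛ : periodLatticeGamma1 D'.f = periodLattice D'.f
  · -- STEVENS' CURVE = THE OPTIMAL CURVE (`Λ₁ = Λ₀`): an even `c` would force `Λ₁ ≠ Λ₀`
    obtain ⟨e, he⟩ := exists_isRoot_twoTorsionPolynomial_of_not_hasIrreducibleModPGaloisRep_two (C • W) hred'
    exact fun h2 ↦ hEven (C • W) D' hopt' e he h2 hΛ
  · -- THE GAIN LOCUS `Λ₁ ≠ Λ₀`
    have h0 : modularSymbol D'.f 0 ∉ periodLattice D'.f := modularSymbol_zero_not_mem_of_ne_of_print hFstar hFnat hex D' hopt' hΛ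
    intro h2
    -- the optimal `X₁(N)`-datum and the row E-an-151|_G: no doubling
    obtain ⟨W₁, i₁, i₂, D₁, hiso, hD₁⟩ := hex (C • W) D' hopt'
    have hf₁ : D₁.f = D'.f := D₁.f_eq_of_isIsogenous D' hiso
    have heq := h151N W₁ (C • W) D₁ D' hiso hD₁ hopt' hssC hcoreC h0 hΛ ha₁ ha₃
    -- index 4 would double the constant
    have hidx : ¬ (∀ z : ℂ, z ∈ periodLatticeGamma1 D'.f ↔ ∃ w ∈ periodLattice D'.f, z = 2 * w) := by
      intro hidx4
      have hd := natAbs_maninConstant₀_eq_two_mul_of_index_four D₁ D' hD₁ hopt' (fun z ↦ by rw [hf₁]; exact hidx4 z)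
      have hne : D₁.maninConstant.natAbs ≠ 0 := Int.natAbs_ne_zero.mpr D₁.maninConstant_ne_zero
      omega
    -- the kernel generator is a BLIND rational root (LEAD's converse Vélu step)
    obtain ⟨w, hw, hw2⟩ := exists_mem_periodLatticeGamma1_ne_two_mul_of_not_indexFour D' h4 hidx
    obtain ⟨A₂, A₄, E, hA₂, hA₄, hE, -, hbl⟩ := shimuraKernelBlindAt_of_natAbs_eq D₁ D' hiso hD₁ hopt' h4 ha₁ ha₃ heq hΛ hw hw2
    have hErt : (C • W).twoTorsionPolynomial.toPoly.IsRoot (E : ℚ) := (isRoot_twoTorsionPolynomial_iff_of_a₁_a₃ (C • W) ha₁ ha₃ _).mpr hE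
    by_cases hsec : ∃ e : ℚ, (C • W).twoTorsionPolynomial.toPoly.IsRoot e ∧ e ≠ (E : ℚ)
    · -- a SECOND rational root: UDC₂ twice forces index 4
      obtain ⟨e, he, hne⟩ := hsec
      exact hTwoRootsN (C • W) D' hopt' e E he hErt hne hidx h2
    · -- `E` is the only rational root: the curve is totally blind — the blind road with 6♭‴|_G
      push Not at hsec
      have hall : AllRationalTwoTorsionBlind (C • W) := fun e he ↦
        ⟨A₂, A₄, E, hA₂, hA₄, (hsec e ((isRoot_twoTorsionPolynomial_iff_of_a₁_a₃ (C • W) ha₁ ha₃ e).mpr he)).symm, hbl⟩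
      have hT : HasRationalTwoTorsion (C • W) := ⟨E, hE⟩
      -- Stevens' parity for `D₁`: from F-es-21♭K on the period-dominated locus, from the row OddStevens|_G otherwise
      have hodd₁ : ¬ (2 : ℤ) ∣ D₁.maninConstant := by
        by_cases hdom : ∃ (V' : WeierstrassCurve ℚ) (_ : V'.IsElliptic) (_ : V'.IsGloballyMinimal) (q m : ℤ),
            Odd q ∧ WeierstrassCurve.IsIsogenous V' W₁ ∧ (q : ℝ) * V'.realPeriodRat = (m : ℝ) * W₁.realPeriodRat ∧
            IsSymbolClosureCurve V' D₁.f
        · obtain ⟨V', _, _, q, m, hq, hiso', hΩ, hsc⟩ := hdom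
          exact not_two_dvd_maninConstant₁_of_katoFactAt W₁ D₁ hD₁ h4
            (katoFactTwoAt_of_isIsogenous_of_realPeriod_ratio W₁ V' D₁.f h4 hiso' q m hq hΩ (hK V' D₁.f hsc))
        · exact hOddN W₁ D₁ hD₁ hdom ⟨C • W, inferInstance, hmin, D', hiso, hopt', ha₁, ha₃, hT, hall, hssC, hcoreC, h0, hΛ⟩
      -- no doubling transfers it to `D'`
      apply hodd₁
      have : (2 : ℤ).natAbs ∣ D₁.maninConstant.natAbs := by rw [← heq]; exact Int.natAbs_dvd_natAbs.mpr h2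
      exact Int.natAbs_dvd_natAbs.mp this

/-! ## §2 The `16 ∣ N` core form and the route decl from abstract inputs -/

/-- **C2 on the core ∩ {`16 ∣ N`} ⟸ F♯ ∧ F★ ∧ F♮ ∧ CES ∧ F-es-21♭K ∧ `hEven` ∧ `hTwoRoots` ∧ E-an-151|_G ∧ OddStevens|_G** (§1 at `16 ∣ N`).
CONDITIONAL. [cite: Kato2004Asterisque, Thm. 12.5 (1) (p. 221)] [cite: Stevens1989, §2] -/
theorem maninOddAtSixteenCore_of_v29
    (hF : kato_neron_isIntegral_twistedSymbolSum_of_additive_two_real)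
    (hFstar : optimalGamma1Parametrization_cusp_rational) (hFnat : optimalGamma1Parametrization_cuspZero_galoisConjugate)
    (hex : exists_optimal_gamma1ParametrizationData) (hK : kato_isIntegral_twistedSymbolSum_two_symbolClosure)
    (hEven : ∀ (W : WeierstrassCurve ℚ) [W.IsElliptic] [W.IsGloballyMinimal] {N : ℕ} [NeZero N] (D : ModularParametrizationData W N),
      2 ^ 4 ∣ N → (∀ z ∈ D.L.lattice, ∃ w ∈ periodLattice D.f, z = D.c * w) →
      ∀ e : ℚ, W.twoTorsionPolynomial.toPoly.IsRoot e → (2 : ℤ) ∣ D.c → periodLatticeGamma1 D.f ≠ periodLattice D.f)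
    (hTwoRoots : ∀ (W : WeierstrassCurve ℚ) [W.IsElliptic] [W.IsGloballyMinimal] {N : ℕ} [NeZero N] (D : ModularParametrizationData W N),
      2 ^ 4 ∣ N → (∀ z ∈ D.L.lattice, ∃ w ∈ periodLattice D.f, z = D.c * w) →
      ∀ e e' : ℚ, W.twoTorsionPolynomial.toPoly.IsRoot e → W.twoTorsionPolynomial.toPoly.IsRoot e' → e ≠ e' →
      ¬ (∀ z : ℂ, z ∈ periodLatticeGamma1 D.f ↔ ∃ w ∈ periodLattice D.f, z = 2 * w) → ¬ (2 : ℤ) ∣ D.maninConstant)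
    (h151 : ∀ (W₁ W : WeierstrassCurve ℚ) [W₁.IsElliptic] [W₁.IsGloballyMinimal] [W.IsElliptic] [W.IsGloballyMinimal] {N : ℕ} [NeZero N]
      (D₁ : Gamma1ParametrizationData W₁ N) (D : ModularParametrizationData W N), IsIsogenous W₁ W → D₁.IsOptimal →
      2 ^ 4 ∣ N → (∀ z ∈ D.L.lattice, ∃ w ∈ periodLattice D.f, z = D.c * w) →
      ((primesEquiv (R := 𝓞 ℚ)).symm ⟨2, Nat.prime_two⟩).valuation ℚ W.j < 1 →
      (∀ d : ℤ, d = -1 ∨ d = 2 ∨ d = -2 → 2 ≤ (W.quadraticTwist (d : ℚ)).conductorExponent ((primesEquiv (R := ℤ)).symm ⟨2, Nat.prime_two⟩)) →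
      modularSymbol D.f 0 ∉ periodLattice D.f → periodLatticeGamma1 D.f ≠ periodLattice D.f → W.a₁ = 0 → W.a₃ = 0 →
      D.maninConstant.natAbs = D₁.maninConstant.natAbs)
    (hOdd : ∀ (V : WeierstrassCurve ℚ) [V.IsElliptic] [V.IsGloballyMinimal] {N : ℕ} [NeZero N]
      (D₁ : Gamma1ParametrizationData V N), D₁.IsOptimal → 2 ^ 4 ∣ N →
      (¬ ∃ (V' : WeierstrassCurve ℚ) (_ : V'.IsElliptic) (_ : V'.IsGloballyMinimal) (q m : ℤ),
        Odd q ∧ WeierstrassCurve.IsIsogenous V' V ∧ (q : ℝ) * V'.realPeriodRat = (m : ℝ) * V.realPeriodRat ∧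
        IsSymbolClosureCurve V' D₁.f) →
      (∃ (W₀ : WeierstrassCurve ℚ) (_ : W₀.IsElliptic) (_ : W₀.IsGloballyMinimal) (D₀ : ModularParametrizationData W₀ N),
        IsIsogenous V W₀ ∧ (∀ z ∈ D₀.L.lattice, ∃ w ∈ periodLattice D₀.f, z = D₀.c * w) ∧
        W₀.a₁ = 0 ∧ W₀.a₃ = 0 ∧ HasRationalTwoTorsion W₀ ∧ AllRationalTwoTorsionBlind W₀ ∧
        ((primesEquiv (R := 𝓞 ℚ)).symm ⟨2, Nat.prime_two⟩).valuation ℚ W₀.j < 1 ∧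
        (∀ d : ℤ, d = -1 ∨ d = 2 ∨ d = -2 → 2 ≤ (W₀.quadraticTwist (d : ℚ)).conductorExponent ((primesEquiv (R := ℤ)).symm ⟨2, Nat.prime_two⟩)) ∧
        modularSymbol D₀.f 0 ∉ periodLattice D₀.f ∧ periodLatticeGamma1 D₀.f ≠ periodLattice D₀.f) →
      ¬ (2 : ℤ) ∣ D₁.maninConstant)
    :
    mazur_not_dvd_maninConstant_of_odd → abbesUllmo_not_dvd_maninConstant_of_not_dvd_level →
      cesnavicius_not_two_dvd_maninConstant_of_two_dvd_level → exists_isNewformOf →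
      ∀ (W : WeierstrassCurve ℚ) [W.IsElliptic] [W.IsGloballyMinimal] {N : ℕ} [NeZero N] (D : ModularParametrizationData W N),
        (∀ z ∈ D.L.lattice, ∃ w ∈ periodLattice D.f, z = D.c * w) → 2 ^ 4 ∣ N →
        ((primesEquiv (R := 𝓞 ℚ)).symm ⟨2, Nat.prime_two⟩).valuation ℚ W.j < 1 →
        (∀ d : ℤ, d = -1 ∨ d = 2 ∨ d = -2 → 2 ≤ (W.quadraticTwist (d : ℚ)).conductorExponent ((primesEquiv (R := ℤ)).symm ⟨2, Nat.prime_two⟩)) →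
        ¬ (2 : ℤ) ∣ D.maninConstant := by
  intro _hMz _hAU _hCs _hnf W _ _ N _ D hopt h16 hss hcore
  have h4 : 2 ^ 2 ∣ N := dvd_trans ⟨4, by norm_num⟩ h16
  exact not_two_dvd_maninConstant_of_ledgerLawsG_core hF hFstar hFnat hex h4
    (fun V _ _ D' hopt' e he h2 => hEven V D' h16 hopt' e he h2)
    (fun V _ _ D' hopt' e e' he he' hne hidx => hTwoRoots V D' h16 hopt' e e' he he' hne hidx)
    (fun V₁ V _ _ _ _ D₁ D' hiso hD₁ hopt' hssV hcV h0 hΛ h1 h3 => h151 V₁ V D₁ D' hiso hD₁ h16 hopt' hssV hcV h0 hΛ h1 h3)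
    hK (fun V _ _ D₁ hD₁ hno hguard => hOdd V D₁ hD₁ h16 hno hguard) W D hopt hss hcore

/-- **THE ROUTE DECL `Theses.ManinLocalTwoThree.ManinOddAtFour` from the abstract v29 inputs** (§2, the binder-preserving rotation of `…SixteenSplitCore` and
p2's `maninOddAtFour_of_core`).  CONDITIONAL reduction; C2, Manin's conjecture and BSD are NOT proved. [cite: Stevens1989, §2] [cite: Kato2004Asterisque, Thm. 12.5 (1) (p. 221)] -/
theorem maninOddAtFour_of_katoFact_udcTwo_ledgerLawsG
    (hF : kato_neron_isIntegral_twistedSymbolSum_of_additive_two_real)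
    (hFstar : optimalGamma1Parametrization_cusp_rational) (hFnat : optimalGamma1Parametrization_cuspZero_galoisConjugate)
    (hex : exists_optimal_gamma1ParametrizationData) (hK : kato_isIntegral_twistedSymbolSum_two_symbolClosure)
    (hEven : ∀ (W : WeierstrassCurve ℚ) [W.IsElliptic] [W.IsGloballyMinimal] {N : ℕ} [NeZero N] (D : ModularParametrizationData W N),
      2 ^ 4 ∣ N → (∀ z ∈ D.L.lattice, ∃ w ∈ periodLattice D.f, z = D.c * w) →
      ∀ e : ℚ, W.twoTorsionPolynomial.toPoly.IsRoot e → (2 : ℤ) ∣ D.c → periodLatticeGamma1 D.f ≠ periodLattice D.f)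
    (hTwoRoots : ∀ (W : WeierstrassCurve ℚ) [W.IsElliptic] [W.IsGloballyMinimal] {N : ℕ} [NeZero N] (D : ModularParametrizationData W N),
      2 ^ 4 ∣ N → (∀ z ∈ D.L.lattice, ∃ w ∈ periodLattice D.f, z = D.c * w) →
      ∀ e e' : ℚ, W.twoTorsionPolynomial.toPoly.IsRoot e → W.twoTorsionPolynomial.toPoly.IsRoot e' → e ≠ e' →
      ¬ (∀ z : ℂ, z ∈ periodLatticeGamma1 D.f ↔ ∃ w ∈ periodLattice D.f, z = 2 * w) → ¬ (2 : ℤ) ∣ D.maninConstant)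
    (h151 : ∀ (W₁ W : WeierstrassCurve ℚ) [W₁.IsElliptic] [W₁.IsGloballyMinimal] [W.IsElliptic] [W.IsGloballyMinimal] {N : ℕ} [NeZero N]
      (D₁ : Gamma1ParametrizationData W₁ N) (D : ModularParametrizationData W N), IsIsogenous W₁ W → D₁.IsOptimal →
      2 ^ 4 ∣ N → (∀ z ∈ D.L.lattice, ∃ w ∈ periodLattice D.f, z = D.c * w) →
      ((primesEquiv (R := 𝓞 ℚ)).symm ⟨2, Nat.prime_two⟩).valuation ℚ W.j < 1 →
      (∀ d : ℤ, d = -1 ∨ d = 2 ∨ d = -2 → 2 ≤ (W.quadraticTwist (d : ℚ)).conductorExponent ((primesEquiv (R := ℤ)).symm ⟨2, Nat.prime_two⟩)) →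
      modularSymbol D.f 0 ∉ periodLattice D.f → periodLatticeGamma1 D.f ≠ periodLattice D.f → W.a₁ = 0 → W.a₃ = 0 →
      D.maninConstant.natAbs = D₁.maninConstant.natAbs)
    (hOdd : ∀ (V : WeierstrassCurve ℚ) [V.IsElliptic] [V.IsGloballyMinimal] {N : ℕ} [NeZero N]
      (D₁ : Gamma1ParametrizationData V N), D₁.IsOptimal → 2 ^ 4 ∣ N →
      (¬ ∃ (V' : WeierstrassCurve ℚ) (_ : V'.IsElliptic) (_ : V'.IsGloballyMinimal) (q m : ℤ),
        Odd q ∧ WeierstrassCurve.IsIsogenous V' V ∧ (q : ℝ) * V'.realPeriodRat = (m : ℝ) * V.realPeriodRat ∧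
        IsSymbolClosureCurve V' D₁.f) →
      (∃ (W₀ : WeierstrassCurve ℚ) (_ : W₀.IsElliptic) (_ : W₀.IsGloballyMinimal) (D₀ : ModularParametrizationData W₀ N),
        IsIsogenous V W₀ ∧ (∀ z ∈ D₀.L.lattice, ∃ w ∈ periodLattice D₀.f, z = D₀.c * w) ∧
        W₀.a₁ = 0 ∧ W₀.a₃ = 0 ∧ HasRationalTwoTorsion W₀ ∧ AllRationalTwoTorsionBlind W₀ ∧
        ((primesEquiv (R := 𝓞 ℚ)).symm ⟨2, Nat.prime_two⟩).valuation ℚ W₀.j < 1 ∧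
        (∀ d : ℤ, d = -1 ∨ d = 2 ∨ d = -2 → 2 ≤ (W₀.quadraticTwist (d : ℚ)).conductorExponent ((primesEquiv (R := ℤ)).symm ⟨2, Nat.prime_two⟩)) ∧
        modularSymbol D₀.f 0 ∉ periodLattice D₀.f ∧ periodLatticeGamma1 D₀.f ≠ periodLattice D₀.f) →
      ¬ (2 : ℤ) ∣ D₁.maninConstant)
    : Summit.BirchSwinnertonDyer.BirchSwinnertonDyer.Theses.ManinLocalTwoThree.ManinOddAtFour :=
  maninOddAtFour_of_core
    (maninOddAtFourCore_of_maninOddAtSixteenCore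
      (maninOddAtSixteenCore_of_v29 hF hFstar hFnat hex hK hEven hTwoRoots h151 hOdd))

/-! ## §3 The instantiations: UDC₂ = p2's AN2₂ theorem + CDT; the row inline or by -an's name -/

/-- **THE ROUTE DECL BY NAME from the v29-candidate inputs**: F♯, F★, F♮, CES, F-es-21♭K, CDT-algInt (PRINTED) and the OPEN rows {E-an-151|_G, OddStevens|_G} stated INLINE (the v29
skeleton's stubs).  CONDITIONAL reduction; C2, Manin's conjecture and BSD are NOT proved. [cite: CalegariDimitrovTang2025, Thm. 1.0.1 and Remarks 58–59] [cite: KurthLong2008, Prop. 18]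
[cite: Stevens1989, §2] [cite: CesnaviciusNeururerSaha2023, Lemma 6.5] -/
theorem maninOddAtFour_of_katoFact_CDT_ledgerLawsG
    (hF : kato_neron_isIntegral_twistedSymbolSum_of_additive_two_real)
    (hFstar : optimalGamma1Parametrization_cusp_rational) (hFnat : optimalGamma1Parametrization_cuspZero_galoisConjugate)
    (hex : exists_optimal_gamma1ParametrizationData) (hK : kato_isIntegral_twistedSymbolSum_two_symbolClosure)
    (hCDT : Literature.NumberTheory.Automorphic.CalegariDimitrovTang2025_unboundedDenominators_algInt)
    (h151 : ∀ (W₁ W : WeierstrassCurve ℚ) [W₁.IsElliptic] [W₁.IsGloballyMinimal] [W.IsElliptic] [W.IsGloballyMinimal] {N : ℕ} [NeZero N]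
      (D₁ : Gamma1ParametrizationData W₁ N) (D : ModularParametrizationData W N), IsIsogenous W₁ W → D₁.IsOptimal →
      2 ^ 4 ∣ N → (∀ z ∈ D.L.lattice, ∃ w ∈ periodLattice D.f, z = D.c * w) →
      ((primesEquiv (R := 𝓞 ℚ)).symm ⟨2, Nat.prime_two⟩).valuation ℚ W.j < 1 →
      (∀ d : ℤ, d = -1 ∨ d = 2 ∨ d = -2 → 2 ≤ (W.quadraticTwist (d : ℚ)).conductorExponent ((primesEquiv (R := ℤ)).symm ⟨2, Nat.prime_two⟩)) →
      modularSymbol D.f 0 ∉ periodLattice D.f → periodLatticeGamma1 D.f ≠ periodLattice D.f → W.a₁ = 0 → W.a₃ = 0 →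
      D.maninConstant.natAbs = D₁.maninConstant.natAbs)
    (hOdd : ∀ (V : WeierstrassCurve ℚ) [V.IsElliptic] [V.IsGloballyMinimal] {N : ℕ} [NeZero N]
      (D₁ : Gamma1ParametrizationData V N), D₁.IsOptimal → 2 ^ 4 ∣ N →
      (¬ ∃ (V' : WeierstrassCurve ℚ) (_ : V'.IsElliptic) (_ : V'.IsGloballyMinimal) (q m : ℤ),
        Odd q ∧ WeierstrassCurve.IsIsogenous V' V ∧ (q : ℝ) * V'.realPeriodRat = (m : ℝ) * V.realPeriodRat ∧
        IsSymbolClosureCurve V' D₁.f) →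
      (∃ (W₀ : WeierstrassCurve ℚ) (_ : W₀.IsElliptic) (_ : W₀.IsGloballyMinimal) (D₀ : ModularParametrizationData W₀ N),
        IsIsogenous V W₀ ∧ (∀ z ∈ D₀.L.lattice, ∃ w ∈ periodLattice D₀.f, z = D₀.c * w) ∧
        W₀.a₁ = 0 ∧ W₀.a₃ = 0 ∧ HasRationalTwoTorsion W₀ ∧ AllRationalTwoTorsionBlind W₀ ∧
        ((primesEquiv (R := 𝓞 ℚ)).symm ⟨2, Nat.prime_two⟩).valuation ℚ W₀.j < 1 ∧
        (∀ d : ℤ, d = -1 ∨ d = 2 ∨ d = -2 → 2 ≤ (W₀.quadraticTwist (d : ℚ)).conductorExponent ((primesEquiv (R := ℤ)).symm ⟨2, Nat.prime_two⟩)) ∧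
        modularSymbol D₀.f 0 ∉ periodLattice D₀.f ∧ periodLatticeGamma1 D₀.f ≠ periodLattice D₀.f) →
      ¬ (2 : ℤ) ∣ D₁.maninConstant)
    : Summit.BirchSwinnertonDyer.BirchSwinnertonDyer.Theses.ManinLocalTwoThree.ManinOddAtFour :=
  maninOddAtFour_of_katoFact_udcTwo_ledgerLawsG hF hFstar hFnat hex hK
    (fun W _ _ N _ D h16 hopt e he h2 ↦
      UDCTwo.periodLatticeGamma1_ne_of_two_dvd_of_CDT_algInt hCDT W D (dvd_trans ⟨4, by norm_num⟩ h16) hopt he h2)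
    (fun W _ _ N _ D h16 hopt e e' he he' hne hidx ↦
      FullTwoTorsion.not_two_dvd_maninConstant_of_two_roots_of_not_indexFour UDCTwo.sqRootWitnessLaw
        (fun k ↦ UDWOfCDT.unboundedDenominatorsWeightAlgInt_of_CDT_algInt hCDT k) D (dvd_trans ⟨4, by norm_num⟩ h16) hopt he he' hne hidx)
    h151 hOdd

/-- **THE ROUTE DECL BY NAME from -an's NAMED row E-an-151 `ShimuraKernel.GammaOneTransferAtFour`** (stronger than the G-form consumed) + OddStevens|_G inline + the printed facts + CDT.
CONDITIONAL reduction; C2, Manin's conjecture and BSD are NOT proved. [cite: Stevens1989, §2] [cite: CesnaviciusNeururerSaha2023, Lemma 6.5] -/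
theorem maninOddAtFour_of_katoFact_CDT_ledgerRow151
    (hF : kato_neron_isIntegral_twistedSymbolSum_of_additive_two_real)
    (hFstar : optimalGamma1Parametrization_cusp_rational) (hFnat : optimalGamma1Parametrization_cuspZero_galoisConjugate)
    (hex : exists_optimal_gamma1ParametrizationData) (hK : kato_isIntegral_twistedSymbolSum_two_symbolClosure)
    (hCDT : Literature.NumberTheory.Automorphic.CalegariDimitrovTang2025_unboundedDenominators_algInt)
    (h151 : GammaOneTransferAtFour)
    (hOdd : ∀ (V : WeierstrassCurve ℚ) [V.IsElliptic] [V.IsGloballyMinimal] {N : ℕ} [NeZero N]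
      (D₁ : Gamma1ParametrizationData V N), D₁.IsOptimal → 2 ^ 4 ∣ N →
      (¬ ∃ (V' : WeierstrassCurve ℚ) (_ : V'.IsElliptic) (_ : V'.IsGloballyMinimal) (q m : ℤ),
        Odd q ∧ WeierstrassCurve.IsIsogenous V' V ∧ (q : ℝ) * V'.realPeriodRat = (m : ℝ) * V.realPeriodRat ∧
        IsSymbolClosureCurve V' D₁.f) →
      (∃ (W₀ : WeierstrassCurve ℚ) (_ : W₀.IsElliptic) (_ : W₀.IsGloballyMinimal) (D₀ : ModularParametrizationData W₀ N),
        IsIsogenous V W₀ ∧ (∀ z ∈ D₀.L.lattice, ∃ w ∈ periodLattice D₀.f, z = D₀.c * w) ∧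
        W₀.a₁ = 0 ∧ W₀.a₃ = 0 ∧ HasRationalTwoTorsion W₀ ∧ AllRationalTwoTorsionBlind W₀ ∧
        ((primesEquiv (R := 𝓞 ℚ)).symm ⟨2, Nat.prime_two⟩).valuation ℚ W₀.j < 1 ∧
        (∀ d : ℤ, d = -1 ∨ d = 2 ∨ d = -2 → 2 ≤ (W₀.quadraticTwist (d : ℚ)).conductorExponent ((primesEquiv (R := ℤ)).symm ⟨2, Nat.prime_two⟩)) ∧
        modularSymbol D₀.f 0 ∉ periodLattice D₀.f ∧ periodLatticeGamma1 D₀.f ≠ periodLattice D₀.f) →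
      ¬ (2 : ℤ) ∣ D₁.maninConstant)
    : Summit.BirchSwinnertonDyer.BirchSwinnertonDyer.Theses.ManinLocalTwoThree.ManinOddAtFour :=
  maninOddAtFour_of_katoFact_CDT_ledgerLawsG hF hFstar hFnat hex hK hCDT
    (fun W₁ W _ _ _ _ _N _ D₁ D hiso hD₁ h16 hopt _hss _hcore _h0 _hΛ _h1 _h3 ↦ h151 W₁ W D₁ D hiso hD₁ hopt (dvd_trans ⟨4, by norm_num⟩ h16))
    hOdd

end Summit.BirchSwinnertonDyer.BirchSwinnertonDyer.Theorems.ManinLocalTwoThree.LedgerSplit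

end
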